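import Mathlib
import HarnessLib

/-!
# Integers in a quadratic sub-level set: `#{j ∈ ℤ : A j² + 2B j + C ≤ 0} = 2√(B² − AC)/A ± 1` (F_layer OneFcc, flux file (a))

HONEST FRAMING. Venture `Summits/Ventures/Crystal3D` (cell `crystal3d-full`); helper `--supports` the crux `CoaxialWallLaw`
(stmt-Ventures-19481, REGISTERED line `WallLedgerF`) in its role as owner of lane T's debt T-F2 / F_layer, OneFcc half; memo
HOME/wall-19481-p1/g16/TWO-FAMILY-LEDGER-g16.md §Ledger.  Pure elementary counting, standard axioms; nothing about the crux is claimed;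
F-C1 not moved.

WHY.  The flux side of the OneFcc ledger counts, per layer plane and per in-plane root, the lattice lines crossing a cell height inside
a lateral radius.  The crossing points of consecutive lines form an arithmetic progression `Y₀ + j·W` on the plane's horizontal trace, and
`lateral² ≤ R²` is a quadratic condition `A j² + 2B j + C ≤ 0` (`A = ‖W‖² > 0`); the number of its integer solutions is the chord
`2√(B² − AC)/A` up to `±1`:
* the integers of a real interval `[lo, hi]` number `≥ hi − lo − 1` (folklore; the tree has it as `Hallgren2005.le_card_Icc_ceil_floor` in an
  unrelated Literature area, re-derived inline here to keep the import closure inside the venture);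
* `quadratic_nonpos_iff` — for `A > 0`, `B² − AC ≥ 0`: `A x² + 2B x + C ≤ 0 ↔ x ∈ [(−B − √D)/A, (−B + √D)/A]`; `quadratic_pos_of_disc_neg`;
* **`card_int_quadratic_ge`** — every finite `T ⊆ ℤ` containing all integer solutions has `2√((B² − AC)₊)/A − 1 ≤ #T` (sources);
* **`card_int_quadratic_le`** — every finite `T ⊆ ℤ` of solutions has `#T ≤ 2√((B² − AC)₊)/A + 1` (first-entry exits).
WHAT THIS IS NOT: no geometry yet; F-C1 not moved.
-/

namespace Summit.Ventures.Crystal3D.Theorems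

open Finset

/-- A NONEMPTY finite set of integers inside a real interval `[lo, hi]` numbers at most `hi − lo + 1`. -/
theorem int_card_le_of_mem_Icc (lo hi : ℝ) (T : Finset ℤ) (hne : T.Nonempty)
    (hT : ∀ j ∈ T, lo ≤ (j : ℝ) ∧ (j : ℝ) ≤ hi) : (T.card : ℝ) ≤ hi - lo + 1 := by
  obtain ⟨j₀, hj₀⟩ := hne
  have hsub : T ⊆ Finset.Icc ⌈lo⌉ ⌊hi⌋ := by
    intro j hj
    obtain ⟨h1, h2⟩ := hT j hj
    exact Finset.mem_Icc.2 ⟨Int.ceil_le.2 h1, Int.le_floor.2 h2⟩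
  have hle : ⌈lo⌉ ≤ ⌊hi⌋ + 1 := by
    have := Finset.mem_Icc.1 (hsub hj₀); omega
  have hc : (((Finset.Icc ⌈lo⌉ ⌊hi⌋).card : ℤ) : ℝ) = ((⌊hi⌋ + 1 - ⌈lo⌉ : ℤ) : ℝ) := by
    rw [Int.card_Icc_of_le _ _ hle]
  have hcard : ((Finset.Icc ⌈lo⌉ ⌊hi⌋).card : ℝ) = (⌊hi⌋ : ℝ) + 1 - ⌈lo⌉ := by
    have := hc; push_cast at this ⊢; linarith
  have h1 : (lo : ℝ) ≤ ⌈lo⌉ := Int.le_ceil lo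
  have h2 : ((⌊hi⌋ : ℝ)) ≤ hi := Int.floor_le hi
  have := card_le_card hsub
  have : (T.card : ℝ) ≤ ((Finset.Icc ⌈lo⌉ ⌊hi⌋).card : ℝ) := by exact_mod_cast this
  linarith

/-- A quadratic with positive leading coefficient and negative discriminant is positive. -/
theorem quadratic_pos_of_disc_neg {A B C : ℝ} (hA : 0 < A) (hD : B ^ 2 - A * C < 0) (x : ℝ) :
    0 < A * x ^ 2 + 2 * B * x + C := by
  have key : A * (A * x ^ 2 + 2 * B * x + C) = (A * x + B) ^ 2 - (B ^ 2 - A * C) := by ring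
  have : 0 < A * (A * x ^ 2 + 2 * B * x + C) := by rw [key]; nlinarith [sq_nonneg (A * x + B)]
  exact pos_of_mul_pos_right this hA.le

/-- The sub-level set of a quadratic with positive leading coefficient and nonnegative discriminant is the root interval. -/
theorem quadratic_nonpos_iff {A B C : ℝ} (hA : 0 < A) (hD : 0 ≤ B ^ 2 - A * C) (x : ℝ) :
    A * x ^ 2 + 2 * B * x + C ≤ 0 ↔
      (-B - Real.sqrt (B ^ 2 - A * C)) / A ≤ x ∧ x ≤ (-B + Real.sqrt (B ^ 2 - A * C)) / A := by
  set s := Real.sqrt (B ^ 2 - A * C) with hs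
  have hs0 : 0 ≤ s := Real.sqrt_nonneg _
  have hs2 : s ^ 2 = B ^ 2 - A * C := Real.sq_sqrt hD
  have key : A * (A * x ^ 2 + 2 * B * x + C) = (A * x + B) ^ 2 - s ^ 2 := by rw [hs2]; ring
  constructor
  · intro h
    have h1 : (A * x + B) ^ 2 ≤ s ^ 2 := by nlinarith
    obtain ⟨hl, hr⟩ := abs_le_of_sq_le_sq' h1 hs0
    constructor
    · rw [div_le_iff₀ hA]; linarith
    · rw [le_div_iff₀ hA]; linarith
  · rintro ⟨hl, hr⟩
    rw [div_le_iff₀ hA] at hl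
    rw [le_div_iff₀ hA] at hr
    have h1 : (A * x + B) ^ 2 ≤ s ^ 2 := by
      have ha : -s ≤ A * x + B := by linarith
      have hb : A * x + B ≤ s := by linarith
      nlinarith
    have : A * (A * x ^ 2 + 2 * B * x + C) ≤ 0 := by rw [key]; linarith
    by_contra hpos
    push Not at hpos
    have := mul_pos hA hpos
    linarith

/-- **Lower count**: a finite set of integers containing every integer solution of `A j² + 2B j + C ≤ 0` (`A > 0`) has at least
`2√((B² − AC)₊)/A − 1` members. -/
theorem card_int_quadratic_ge {A B C : ℝ} (hA : 0 < A) (T : Finset ℤ)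
    (hT : ∀ j : ℤ, A * (j : ℝ) ^ 2 + 2 * B * (j : ℝ) + C ≤ 0 → j ∈ T) :
    2 * Real.sqrt (max 0 (B ^ 2 - A * C)) / A - 1 ≤ (T.card : ℝ) := by
  by_cases hD : 0 ≤ B ^ 2 - A * C
  · rw [max_eq_right hD]
    set s := Real.sqrt (B ^ 2 - A * C) with hs
    set lo := (-B - s) / A with hlo
    set hi := (-B + s) / A with hhi
    have hsub : Finset.Icc ⌈lo⌉ ⌊hi⌋ ⊆ T := by
      intro j hj
      obtain ⟨h1, h2⟩ := Finset.mem_Icc.1 hj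
      refine hT j ((quadratic_nonpos_iff hA hD (j : ℝ)).2 ⟨?_, ?_⟩)
      · exact (Int.ceil_le.1 h1)
      · exact (Int.le_floor.1 h2)
    have h1 : hi - lo - 1 ≤ ((Finset.Icc ⌈lo⌉ ⌊hi⌋).card : ℝ) := by
      have c1 : (⌈lo⌉ : ℝ) < lo + 1 := Int.ceil_lt_add_one lo
      have c2 : hi < (⌊hi⌋ : ℝ) + 1 := Int.lt_floor_add_one hi
      by_cases hle : ⌈lo⌉ ≤ ⌊hi⌋ + 1
      · have hc : (((Finset.Icc ⌈lo⌉ ⌊hi⌋).card : ℤ) : ℝ) = ((⌊hi⌋ + 1 - ⌈lo⌉ : ℤ) : ℝ) := by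
          rw [Int.card_Icc_of_le _ _ hle]
        have : ((Finset.Icc ⌈lo⌉ ⌊hi⌋).card : ℝ) = (⌊hi⌋ : ℝ) + 1 - ⌈lo⌉ := by
          have := hc; push_cast at this ⊢; linarith
        rw [this]; linarith
      · push Not at hle
        have : ((⌊hi⌋ : ℝ)) + 1 < ⌈lo⌉ := by exact_mod_cast hle
        have h0 : (0 : ℝ) ≤ ((Finset.Icc ⌈lo⌉ ⌊hi⌋).card : ℝ) := Nat.cast_nonneg _
        linarith
    have h2 : ((Finset.Icc ⌈lo⌉ ⌊hi⌋).card : ℝ) ≤ (T.card : ℝ) := by exact_mod_cast card_le_card hsub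
    have e : hi - lo = 2 * s / A := by rw [hhi, hlo]; field_simp; ring
    linarith
  · push Not at hD
    rw [max_eq_left hD.le, Real.sqrt_zero, mul_zero, zero_div]
    have h0 : (0 : ℝ) ≤ (T.card : ℝ) := Nat.cast_nonneg _
    linarith

/-- **Upper count**: a finite set of integer solutions of `A j² + 2B j + C ≤ 0` (`A > 0`) has at most `2√((B² − AC)₊)/A + 1` members. -/
theorem card_int_quadratic_le {A B C : ℝ} (hA : 0 < A) (T : Finset ℤ)
    (hT : ∀ j ∈ T, A * (j : ℝ) ^ 2 + 2 * B * (j : ℝ) + C ≤ 0) :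
    (T.card : ℝ) ≤ 2 * Real.sqrt (max 0 (B ^ 2 - A * C)) / A + 1 := by
  have hsq0 : 0 ≤ 2 * Real.sqrt (max 0 (B ^ 2 - A * C)) / A := by positivity
  by_cases hne : T.Nonempty
  · obtain ⟨j₀, hj₀⟩ := hne
    have hD : 0 ≤ B ^ 2 - A * C := by
      by_contra hD; push Not at hD
      have := quadratic_pos_of_disc_neg hA hD (j₀ : ℝ)
      linarith [hT j₀ hj₀]
    rw [max_eq_right hD]
    set s := Real.sqrt (B ^ 2 - A * C) with hs
    set lo := (-B - s) / A with hlo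
    set hi := (-B + s) / A with hhi
    have h1 := int_card_le_of_mem_Icc lo hi T ⟨j₀, hj₀⟩ fun j hj => (quadratic_nonpos_iff hA hD (j : ℝ)).1 (hT j hj)
    have e : hi - lo = 2 * s / A := by rw [hhi, hlo]; field_simp; ring
    linarith
  · rw [Finset.not_nonempty_iff_eq_empty.1 hne, card_empty, Nat.cast_zero]
    linarith

end Summit.Ventures.Crystal3D.Theorems
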